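import Summits.QuantumFields.BalabanUV.Beta.FP.TorusCompositeCovarianceOne
import Summits.QuantumFields.BalabanUV.Beta.FP.PeriodisedSymBorderWardContact

/-!
# `BalabanUV.Beta.FP.TorusStepInsertionSym` — road «FP» for binder row D1, ROUTE T, RE-BASING (β1) (the row's RULING R-D1-g52-1, journal l.56283:
# «the composite tower is re-based on an1's (0.4)-SYMMETRISED bricks at the centred root at every level»; leaf-02's WANTED there: «sym twins of R-5 ∕ R-6
# `TorusStepInsertionPeriodic(Two)` (`stepIns₁Sym ∕ stepIns₂₂Sym` over `symVhSAt ∕ symVh₂SAt`), then R-7…R-17 one pass each»): **ORDER 1, ONE STEP, CENTRED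
# ROOT — THE (0.4)-SYMMETRISED FIRST-ORDER INSERTION JET ALONG A BOND WEIGHT: ITS GAUGE-COVARIANCE LAW ON ALL COLUMNS (the sym twin of C2
# `TorusCompositeCovarianceOne.stepIns₁_mul_tgrad`) AND ITS ACTION ON PERIODIC 1-FORMS AS an1's SYMMETRISED FIELD–MULTIPLIER KERNEL (the sym twin
# of R-5 `TorusStepInsertionPeriodic`)** — the first supplier of the re-based tower on leaf-02's side (R-D1-g52-1 (c) ORDER: «leaf-06 `compRowsG` ∥
# K-U3d sym defs ∥ leaf-02 `stepIns` twins → leaf-02 R-passes ∥ d1-p3 generator passes»).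

WHY.  Under (β1) the tower's one-step brick is an1's symmetrised first-order border table `symVhSAt (ctr (d+1) Lc)` (`SymAveragingHessianCounts`: node 7a's
packer `packVH` applied to `symVhKerAt`) at the CENTRED root, instead of the rooted `vhSAt (toSite r)`; the rooted files C2 (my g22) and R-5 (my g28) STAY
(every landed byte stays; the twin is a NEW file beside them).  This file is their VERBATIM twin under `vhSAt (toSite r) ↦ symVhSAt (ctr (d+1) Lc)`, `vhKerAt
(toSite r) ↦ symVhKerAt (ctr (d+1) Lc)`, `bhKStepAt d (toSite r) Lc ℓ ↦ bhKStepSh d Lc (Dsh Lc) ℓ`, `r ↦ ctrOff (d+1) Lc` (`ctr = toSite ∘ ctrOff` by `rfl`;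
the far root is `rootPt M Lc hc` at `hc : ctrOff (d+1) Lc ∈ box (d+1) Lc`), with an1's letters swapped name for name (`vhSAt_translate ↦ symVhSAt_translate`,
`vhKerAt_eq_zero_left∕right ↦ symVhKerAt_eq_zero_left∕right`, `packVH_inr_inl` unchanged) and the one-step Ward supplier `PeriodisedBorderWardContact.
submatrix_vhSAt_mul_tgrad` (my g17) ↦ `PeriodisedSymBorderWardContact.submatrix_symVhSAt_mul_tgrad` (my g21) — SAME four slots, SAME `Tip − Far-root` shape
(R-FP-67 «(COV-m) row shapes survive, order by order»).  The COMPOSITE objects (`compIns₁Sym`, its chain rule and covariance law; R-7's sym pass) follow the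
hour leaf-06's `compRowsG ∕ QstepSym ∕ compRowsSym` (`FP/TorusCompositeObjectsG`, R-D1-g52-1 (c)) is in the tree — NOT in this file; here the sym one-step
rows are DISPLAYED by a presentation binder `hQ : Q = perF (bhKStepSh d Lc (Dsh Lc) ℓ)∘((coarsePt, inr), (·, inl))` (leaf-06's `QstepSym` by `rfl` once typed).

WHAT (level-free; `d` generic; root CENTRED; `hc : ctrOff (d+1) Lc ∈ box (d+1) Lc`, e.g. `ctrOff_mem_box` at `1 ≤ Lc`).  §1 [our object — bookkeeping]
**`stepIns₁Sym M Lc w`** `:= Σ_b w b • perF (dper (symVhSAt (ctr (d+1) Lc) b))∘((coarsePt, inr), (·, inl))`; `stepIns₁Sym_apply`; **`stepIns₁Sym_mul_tgrad`**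
(`hQ` as above, ANY level `ℓ`): `stepIns₁Sym w · D_fine = c_ℓ • (Q · Tip(w) − Far(Q · w))`, `Tip(w)(b, s) = w b · [s ≡ b.1 + e_{b.2}]`, `Far(v)(a, s) = v a ·
[s = rootPt M Lc hc (a.1 + e_{a.2})]`, `c_ℓ = (Lc^{d+1}·stepScale d Lc ℓ)⁻¹` — character for character C2 at `r := ctrOff (d+1) Lc`, `Qstep Lc M ℓ r ↦ Q`.  §2 ONE
BACKGROUND BOND: `symVhSAt_zsmul_inr_inl` (at a coarse multiplier site the `(inr, inl)` entry of the sym TABLE is the sym KERNEL — `packVH_inr_inl`),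
`summable_symVhKerAt_mul ∕ summable_sum_symVhKerAt_mul ∕ tsum_symVhKerAt_mul_eq_zero_of_not_mem` (finite support in either bond, an1's
`symVhKerAt_eq_zero_left∕right`), **`sum_perF_dper_symVhSAt_mul_periodic`**: `Σ_{y,l} perF (dper (symVhSAt (ctr) κ′ u)) (coarsePt x, inr κ) (y, inl l) · B l y
= Σ'_m Σ'_z Σ_l symVhKerAt (ctr) Lc κ x (l, z) (κ′, u + (fine Lc M)∘m) · B l z` (R-5 §2's twin; two [folklore] helpers of R-5 §1 — the torus pairing with a
periodic form, finitely many loaded translates — are re-proved here as PRIVATE local copies ONLY because R-5's module `FP.TorusStepInsertionPeriodic` (p370150 ✓)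
has no hub olean yet (build-lane backlog, my INFRA-1 l.56207) and so cannot be imported by a file that is to verify now; to be de-duplicated by `import` in a
later cut).  §3 THE WEIGHTED SUM: **`sum_stepIns₁Sym_mul_periodic_eq_sum_bonds`**, **`sum_stepIns₁Sym_mul_periodic`**: `Σ_q stepIns₁Sym M Lc w (x, κ) q · B q.2
q.1 = Σ'_u Σ_{κ′} (Σ'_z Σ_l symVhKerAt (ctr (d+1) Lc) Lc κ x (l, z) (κ′, u) · B l z) · w (wrapPt (fine Lc M) u, κ′)` (R-5 §3's twin = R-7's sym pass reads this
line BY NAME).  [our object] one bookkeeping def + [folklore] finite sums BY NAME; no `def … : Prop`, nothing cited, 0 sorry.  Nothing of the dictionary ∕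
Bałaban's asserted (that the (0.4) brick IS the record's one-step averaging table is an1's ∕ the row's word — ROOT M‴, R-D1-g52-1 — not this file's).

HONEST DEPENDENCY (page 1, mandatory): continuum YM on T⁴ ⇐ BetaPertH ∧ nine spine estimates (0/9 proved); BetaPertH ⇐ (D1) ∧ (D4) ∧ CAP+tail;
G-an2-4 gates asym, D1 and NE2/3/4.  HONEST FRAMING (cell contract, verbatim): «discharging `BetaPertH` makes Bałaban's UV stability UNCONDITIONAL —
a real constructive-QFT result; it is NOT the continuum limit and NOT the Clay problem.»  ABSOLUTE RULE (cell charter, verbatim): «No internally-minted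
statement may enter as a cited fact. Every hypothesis is either kernel-proved in this package or a verbatim quotation of a PUBLISHED theorem with page
reference. The manuscript(s) under audit are NOT citable for their own disputed steps — they are the thing under adjudication; programme-internal
(2001/route/tribunal) claims are never citable.»  0 estimates; 0∕4 row-D1 binders (hW, hR, D1Tel, D1Rep); NOT (C1), NOT (T-ID), NOT SDF, NOT D1,
NOT BetaPertH, NOT continuum, NOT Clay.  D1 formalisation swarm LEAF PROVER 02 (b2b-balaban-beta-d1-formalise-leaf-02 gen 30), 2026-08-24.  No existing file touched.
-/

noncomputable section

open scoped BigOperators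

namespace Summit.QuantumFields.BalabanUV.Beta.FP.TorusStepInsertionSym

open Matrix Finset
open Literature.MathematicalPhysics.QuantumFieldTheory
open Literature.MathematicalPhysics.QuantumFieldTheory.Balaban1983to89
open Literature.MathematicalPhysics.QuantumFieldTheory.Balaban1983to89.Beta
open B5Prop11Plancherel (fine)
open B6Lemma24Torus (pbox mem_pbox wrap)
open B4TorusKernel.MultiPeriod (translate translate_apply translate_injective)
open Summit.QuantumFields.BalabanUV.Beta.GAN24.DirichletExhaustionPeriodise (one_le_M)
open ExpKernelCalculus (MKer)
open AffineAveraging (Site Form1 box toSite unitVec)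
open AveragingContours (off blk)
open AveragingContoursRooted (ctr ctrOff ctrOff_mem_box)
open AveragingHessianKernels (Bond Near packVH_inr_inl)
open OneStepResolventKernel (Fib proj_zsmul quo_zsmul)
open LatticeForm (quo)
open Summit.QuantumFields.BalabanUV.Beta.BorderedHessian (stepScale stepScale_ne_zero off_eq_zero_iff_proj blk_eq_quo)
open Summit.QuantumFields.BalabanUV.Beta.DshAn1 (Dsh)
open Summit.QuantumFields.BalabanUV.Beta.SymAveragingHessianCounts (symVhKerAt symVhKerAt_eq_zero_left symVhKerAt_eq_zero_right symVhSAt symVhSAt_translate)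
open Summit.QuantumFields.BalabanUV.Beta.SymShiftedSpread (bhKStepSh)
open Summit.QuantumFields.BalabanUV.Beta.GAN24.KernelPeriodisation (wrap_translate)
open Summit.QuantumFields.BalabanUV.Beta.FP.KernelPeriodisationFib (Idx perF perF_apply perZ perZ_apply)
open Summit.QuantumFields.BalabanUV.Beta.FP.KernelPeriodisationFibLoc (dper dper_apply)
open Summit.QuantumFields.BalabanUV.Beta.FP.KernelPeriodisationFibTrace (tsum_sites_eq_sum_tsum)
open Summit.QuantumFields.BalabanUV.Beta.FP.PeriodisedBorderTables (dper_apply_of_blockCov)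
open Summit.QuantumFields.BalabanUV.Beta.FP.TorusGaugeCovariance (tdelta tgrad nearBox mem_nearBox)
open Summit.QuantumFields.BalabanUV.Beta.FP.TorusGaugeCovariancePairing (wrapPt wrapPt_coe wrapPt_of_mem)
open Summit.QuantumFields.BalabanUV.Beta.FP.TorusGaugeCovarianceCoarse (coarsePt coarsePt_coe)
open Summit.QuantumFields.BalabanUV.Beta.FP.PeriodisedSymBorderWardContact (submatrix_symVhSAt_mul_tgrad)
open Summit.QuantumFields.BalabanUV.Beta.FP.TorusCompositeCovariance (rootPt wrapPt_coarsePt_add_add)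
open Summit.QuantumFields.BalabanUV.Beta.FP.TorusCompositeCovarianceOne (tdelta_wrapPt)

variable {d : ℕ}

/-! ## §1 One step, CENTRED root: the symmetrised first-order insertion jet along a bond weight, and its covariance law on ALL gauge columns -/

section OneStep

variable (M : Fin (d + 1) → ℕ) [∀ μ, NeZero (M μ)] (Lc : ℕ) [NeZero Lc]

omit [∀ μ, NeZero (M μ)] in
/-- [our object — bookkeeping] **THE (0.4)-SYMMETRISED ONE-STEP FIRST-ORDER INSERTION JET ALONG A BOND WEIGHT `w`** of the symmetrised averaging
`M ← fine Lc M` at the CENTRED root `ctr (d+1) Lc`: `Σ_b w b •` an1's symmetrised first-order border table `symVhSAt (ctr (d+1) Lc) b.2 b.1`, periodised on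
the fine torus, read on ((coarse multiplier slots at `coarsePt`, `inr`), (fine field slots, `inl`)) — the sym twin of `TorusCompositeCovarianceOne.stepIns₁`
(there: `vhSAt (toSite r)`), level-free. -/
def stepIns₁Sym (w : ↥(pbox (fine Lc M)) × Fin (d + 1) → ℝ) :
    Matrix (↥(pbox M) × Fin (d + 1)) (↥(pbox (fine Lc M)) × Fin (d + 1)) ℝ :=
  ∑ b : ↥(pbox (fine Lc M)) × Fin (d + 1), w b •
    (perF (fine Lc M) (dper (fine Lc M) (symVhSAt (ctr (d + 1) Lc) d Lc rfl b.2 (b.1 : Site (d + 1))))).submatrix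
      (fun a : ↥(pbox M) × Fin (d + 1) => ((coarsePt M Lc a.1, Sum.inr a.2) : Idx (fine Lc M) (Fib d)))
      (fun b : ↥(pbox (fine Lc M)) × Fin (d + 1) => ((b.1, Sum.inl b.2) : Idx (fine Lc M) (Fib d)))

omit [∀ μ, NeZero (M μ)] in
/-- [folklore] the sym one-step jet entrywise: `(stepIns₁Sym w)(a, c) = Σ_b w b · M^{b,sym}(a, c)`, `M^{b,sym}` the symmetrised torus member of the bond `b`
(twin of `TorusCompositeCovarianceTwoStep.stepIns₁_apply`). -/
theorem stepIns₁Sym_apply (w : ↥(pbox (fine Lc M)) × Fin (d + 1) → ℝ) (a : ↥(pbox M) × Fin (d + 1)) (c : ↥(pbox (fine Lc M)) × Fin (d + 1)) :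
    stepIns₁Sym M Lc w a c = ∑ b : ↥(pbox (fine Lc M)) × Fin (d + 1),
      w b * perF (fine Lc M) (dper (fine Lc M) (symVhSAt (ctr (d + 1) Lc) d Lc rfl b.2 (b.1 : Site (d + 1)))) (coarsePt M Lc a.1, Sum.inr a.2) (c.1, Sum.inl c.2) := by
  rw [stepIns₁Sym, Matrix.sum_apply]
  exact Finset.sum_congr rfl fun b _ => by rw [Matrix.smul_apply, smul_eq_mul, Matrix.submatrix_apply]

/-- [folklore] **`stepIns₁Sym_mul_tgrad` — THE ONE-STEP COVARIANCE LAW OF THE SYMMETRISED JET ON ALL GAUGE COLUMNS** (my g21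
`PeriodisedSymBorderWardContact.submatrix_symVhSAt_mul_tgrad`, weighted; ANY level `ℓ` on the right — `c_ℓ • Q_ℓ` is level-free; the sym one-step rows
DISPLAYED by the presentation binder `hQ : Q = perF (bhKStepSh d Lc (Dsh Lc) ℓ)∘((coarsePt, inr), (·, inl))`, leaf-06's `QstepSym` by `rfl` once typed;
`hc : ctrOff (d+1) Lc ∈ box (d+1) Lc`, e.g. `ctrOff_mem_box` at `1 ≤ Lc`): `stepIns₁Sym w · D_fine = c_ℓ • (Q · Tip(w) − Far(Q · w))` — the TIP contact
`Tip(w)(b, s) = w b · [s ≡ b.1 + e_{b.2}]` and the FAR-ROOT contact `Far(v)(a, s) = v a · [s = rootPt M Lc hc (a.1 + e_{a.2})]` (the CENTRED root site of the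
far block of the coarse bond `a`, `wrapPt_coarsePt_add_add` at `r := ctrOff (d+1) Lc`), `c_ℓ = (Lc^{d+1}·stepScale d Lc ℓ)⁻¹`.  Character for character
`TorusCompositeCovarianceOne.stepIns₁_mul_tgrad` at `r := ctrOff (d+1) Lc`, `Qstep Lc M ℓ r ↦ Q`. -/
theorem stepIns₁Sym_mul_tgrad (hc : ctrOff (d + 1) Lc ∈ box (d + 1) Lc) (ℓ : ℕ)
    {Q : Matrix (↥(pbox M) × Fin (d + 1)) (↥(pbox (fine Lc M)) × Fin (d + 1)) ℝ}
    (hQ : Q = (perF (fine Lc M) (bhKStepSh d Lc (Dsh Lc) ℓ)).submatrix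
        (fun a : ↥(pbox M) × Fin (d + 1) => ((coarsePt M Lc a.1, Sum.inr a.2) : Idx (fine Lc M) (Fib d)))
        (fun b : ↥(pbox (fine Lc M)) × Fin (d + 1) => ((b.1, Sum.inl b.2) : Idx (fine Lc M) (Fib d))))
    (w : ↥(pbox (fine Lc M)) × Fin (d + 1) → ℝ) :
    stepIns₁Sym M Lc w * (tgrad (fine Lc M)).submatrix (fun b : ↥(pbox (fine Lc M)) × Fin (d + 1) => ((b.1, Sum.inl b.2) : Idx (fine Lc M) (Fib d))) id
      = ((Lc : ℝ) ^ (d + 1) * stepScale d Lc ℓ)⁻¹ •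
          (Q * Matrix.of (fun (b : ↥(pbox (fine Lc M)) × Fin (d + 1)) (s : ↥(pbox (fine Lc M))) =>
              w b * tdelta (fine Lc M) ((b.1 : Site (d + 1)) + unitVec b.2) s)
            - Matrix.of (fun (a : ↥(pbox M) × Fin (d + 1)) (s : ↥(pbox (fine Lc M))) =>
                (Q *ᵥ w) a
                  * tdelta (fine Lc M) ((rootPt M Lc hc (wrapPt M ((a.1 : Site (d + 1)) + unitVec a.2)) : ↥(pbox (fine Lc M))) : Site (d + 1)) s)) := by
  subst hQ
  ext a s
  have key : ∀ b : ↥(pbox (fine Lc M)) × Fin (d + 1),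
      ((perF (fine Lc M) (dper (fine Lc M) (symVhSAt (ctr (d + 1) Lc) d Lc rfl b.2 (b.1 : Site (d + 1))))).submatrix
            (fun a : ↥(pbox M) × Fin (d + 1) => ((coarsePt M Lc a.1, Sum.inr a.2) : Idx (fine Lc M) (Fib d)))
            (fun b : ↥(pbox (fine Lc M)) × Fin (d + 1) => ((b.1, Sum.inl b.2) : Idx (fine Lc M) (Fib d)))
          * (tgrad (fine Lc M)).submatrix (fun b : ↥(pbox (fine Lc M)) × Fin (d + 1) => ((b.1, Sum.inl b.2) : Idx (fine Lc M) (Fib d))) id) a s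
        = (tdelta (fine Lc M) ((b.1 : Site (d + 1)) + unitVec b.2) s
            - tdelta (fine Lc M) ((rootPt M Lc hc (wrapPt M ((a.1 : Site (d + 1)) + unitVec a.2)) : ↥(pbox (fine Lc M))) : Site (d + 1)) s)
          * ((((Lc : ℝ) ^ (d + 1) * stepScale d Lc ℓ)⁻¹)
              * (perF (fine Lc M) (bhKStepSh d Lc (Dsh Lc) ℓ)).submatrix
                  (fun a : ↥(pbox M) × Fin (d + 1) => ((coarsePt M Lc a.1, Sum.inr a.2) : Idx (fine Lc M) (Fib d)))
                  (fun b : ↥(pbox (fine Lc M)) × Fin (d + 1) => ((b.1, Sum.inl b.2) : Idx (fine Lc M) (Fib d))) a b) := fun b => by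
    rw [submatrix_symVhSAt_mul_tgrad (M := fine Lc M) (M' := M) (fun i => rfl) ℓ (fun a : ↥(pbox M) × Fin (d + 1) => (coarsePt M Lc a.1 : Site (d + 1)))
      (fun a => (coarsePt M Lc a.1).2) (fun a : ↥(pbox M) × Fin (d + 1) => a.2) id b.2 b.1 a s,
      show ctr (d + 1) Lc = toSite (ctrOff (d + 1) Lc) from rfl,
      ← tdelta_wrapPt (fine Lc M) ((coarsePt M Lc a.1 : Site (d + 1)) + toSite (ctrOff (d + 1) Lc) + (Lc : ℤ) • unitVec a.2), wrapPt_coarsePt_add_add M Lc hc]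
    rfl
  rw [stepIns₁Sym, Matrix.sum_mul, Matrix.sum_apply]
  simp only [Matrix.smul_mul, Matrix.smul_apply, smul_eq_mul, key]
  simp only [Matrix.sub_apply, Matrix.mul_apply, Matrix.of_apply, Matrix.mulVec, dotProduct, Finset.sum_mul, mul_sub, Finset.mul_sum]
  rw [← Finset.sum_sub_distrib]
  exact Finset.sum_congr rfl fun b _ => by ring

end OneStep

/-! ## §2′ Two generic helpers of R-5 §1 (PRIVATE local copies — see the header) -/

section Pairing

variable (M : Fin (d + 1) → ℕ) [∀ μ, NeZero (M μ)]

/-- [folklore] (PRIVATE local copy of R-5 `TorusStepInsertionPeriodic.sum_perZ_mul_periodic`, whose module has no hub olean yet — INFRA-1 l.56207; de-duplicate by `import` later) **THE TORUS PAIRING WITH A PERIODIC FORM IS THE LATTICE PAIRING**: for a kernel `K` whose `(inr μ, inl l)` entries at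
the first slot `x` are summable against the `M`-periodic real 1-form `B` (e.g. finitely supported in the fluctuation slot),
`Σ_{y ∈ pbox M} Σ_l perZ M K x y (inr μ) (inl l) · B l y = Σ'_z Σ_l K x z (inr μ) (inl l) · B l z` (box × period lattice = lattice, `tsum_sites_eq_sum_tsum`). -/
private theorem sum_perZ_mul_periodic (K : MKer (d + 1) (Fib d)) (x : Site (d + 1)) (μ : Fin (d + 1)) (B : Form1 (d + 1) ℝ)
    (hB : ∀ (l : Fin (d + 1)) (y m : Site (d + 1)), B l (translate M y m) = B l y)
    (hK : ∀ l : Fin (d + 1), Summable fun z => K x z (Sum.inr μ) (Sum.inl l) * B l z) :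
    ∑ y : ↥(pbox M), ∑ l : Fin (d + 1), perZ M K x (y : Site (d + 1)) (Sum.inr μ) (Sum.inl l) * B l (y : Site (d + 1))
      = ∑' z : Site (d + 1), ∑ l : Fin (d + 1), K x z (Sum.inr μ) (Sum.inl l) * B l z := by
  set H : Fin (d + 1) → Site (d + 1) → ℝ := fun l z => K x z (Sum.inr μ) (Sum.inl l) * B l z with hH
  have hterm : ∀ (y : ↥(pbox M)) (l : Fin (d + 1)),
      perZ M K x (y : Site (d + 1)) (Sum.inr μ) (Sum.inl l) * B l (y : Site (d + 1))
        = ∑' m : Site (d + 1), H l (translate M (y : Site (d + 1)) m) := fun y l => by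
    rw [perZ_apply, ← tsum_mul_right]
    refine tsum_congr fun m => ?_
    simp only [hH]
    rw [hB]
  calc ∑ y : ↥(pbox M), ∑ l : Fin (d + 1), perZ M K x (y : Site (d + 1)) (Sum.inr μ) (Sum.inl l) * B l (y : Site (d + 1))
      = ∑ y : ↥(pbox M), ∑ l : Fin (d + 1), ∑' m : Site (d + 1), H l (translate M (y : Site (d + 1)) m) :=
        Finset.sum_congr rfl fun y _ => Finset.sum_congr rfl fun l _ => hterm y l
    _ = ∑ l : Fin (d + 1), ∑ y : ↥(pbox M), ∑' m : Site (d + 1), H l (translate M (y : Site (d + 1)) m) := Finset.sum_comm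
    _ = ∑ l : Fin (d + 1), ∑' z : Site (d + 1), H l z := Finset.sum_congr rfl fun l _ => (tsum_sites_eq_sum_tsum M (hK l)).symm
    _ = ∑' z : Site (d + 1), ∑ l : Fin (d + 1), H l z := (Summable.tsum_finsetSum fun l _ => hK l).symm

/-- [folklore] (PRIVATE local copy of R-5 `TorusStepInsertionPeriodic.exists_finset_translate`, same reason) a lattice function vanishing off a finite set, read along the
translates of a point, vanishes off a finite set of translation indices (so its sum over the period lattice is a finite sum; `translate_injective`). -/
private theorem exists_finset_translate (S : Finset (Site (d + 1))) (y : Site (d + 1)) :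
    ∃ F : Finset (Site (d + 1)), ∀ m ∉ F, translate M y m ∉ S := by
  classical
  refine ⟨S.preimage (fun m => translate M y m) (translate_injective (one_le_M M) y).injOn, fun m hm h => hm ?_⟩
  exact Finset.mem_preimage.2 h

end Pairing

/-! ## §2 One background bond, CENTRED root: the torus insertion of an1's SYMMETRISED table acts on periodic forms as `symVhKerAt`, copy by copy -/

section Bond

variable (M : Fin (d + 1) → ℕ) [∀ μ, NeZero (M μ)] (Lc : ℕ) [NeZero Lc]

omit [NeZero Lc] in
/-- [folklore] an1's `symVhKerAt_eq_zero_left` read at the CENTRED root `ctr (d+1) Lc = toSite (ctrOff (d+1) Lc)` (`rfl`). -/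
theorem symVhKerAt_ctr_eq_zero_left (hc : ctrOff (d + 1) Lc ∈ box (d + 1) Lc) {μ : Fin (d + 1)} {y : Site (d + 1)} {f : Bond (d + 1)}
    (h : ¬ Near Lc y f.2) (f' : Bond (d + 1)) : symVhKerAt (ctr (d + 1) Lc) Lc μ y f f' = 0 :=
  symVhKerAt_eq_zero_left hc h f'

omit [NeZero Lc] in
/-- [folklore] an1's `symVhKerAt_eq_zero_right` read at the CENTRED root. -/
theorem symVhKerAt_ctr_eq_zero_right (hc : ctrOff (d + 1) Lc ∈ box (d + 1) Lc) {μ : Fin (d + 1)} {y : Site (d + 1)} (f : Bond (d + 1))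
    {f' : Bond (d + 1)} (h : ¬ Near Lc y f'.2) : symVhKerAt (ctr (d + 1) Lc) Lc μ y f f' = 0 :=
  symVhKerAt_eq_zero_right hc f h

omit [NeZero Lc] in
/-- [folklore] **AT A COARSE MULTIPLIER SITE THE `(inr, inl)` ENTRY OF an1's SYMMETRISED TABLE IS an1's SYMMETRISED KERNEL**: for any root `ρ`, background bond `(κ′, u)`, coarse point
`x` and fluctuation bond `(l, z)`, `symVhSAt ρ d Lc rfl κ′ u (Lc•x) z (inr κ) (inl l) = symVhKerAt ρ Lc κ x (l, z) (κ′, u)` (`packVH_inr_inl` at `off Lc (Lc•x) = 0`, `blk Lc (Lc•x) = x`). -/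
theorem symVhSAt_zsmul_inr_inl [NeZero Lc] (ρ : Site (d + 1)) (κ' : Fin (d + 1)) (u : Site (d + 1)) (x z : Site (d + 1)) (κ l : Fin (d + 1)) :
    symVhSAt ρ d Lc rfl κ' u ((Lc : ℤ) • x) z (Sum.inr κ) (Sum.inl l) = symVhKerAt ρ Lc κ x (l, z) (κ', u) := by
  simp only [symVhSAt, packVH_inr_inl]
  rw [if_pos ((off_eq_zero_iff_proj _).2 (proj_zsmul (N := Lc) x)), blk_eq_quo, quo_zsmul (N := Lc)]

omit [NeZero Lc] in
/-- [folklore] an1's symmetrised kernel is finitely supported in the fluctuation bond (centred root: an1's `symVhKerAt_eq_zero_left`), hence summable against any lattice function. -/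
theorem summable_symVhKerAt_mul (hc : ctrOff (d + 1) Lc ∈ box (d + 1) Lc) (κ : Fin (d + 1)) (x : Site (d + 1)) (l : Fin (d + 1)) (f' : Bond (d + 1))
    (g : Site (d + 1) → ℝ) : Summable fun z : Site (d + 1) => symVhKerAt (ctr (d + 1) Lc) Lc κ x (l, z) f' * g z :=
  summable_of_ne_finset_zero (s := nearBox Lc x) fun z hz => by
    rw [symVhKerAt_ctr_eq_zero_left Lc hc (f := (l, z)) (fun h => hz (mem_nearBox.2 h)) f', zero_mul]

omit [NeZero Lc] in
/-- [folklore] … and the finite sum over the fluctuation directions is summable in the fluctuation site. -/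
theorem summable_sum_symVhKerAt_mul (hc : ctrOff (d + 1) Lc ∈ box (d + 1) Lc) (κ : Fin (d + 1)) (x : Site (d + 1)) (f' : Bond (d + 1)) (B : Form1 (d + 1) ℝ) :
    Summable fun z : Site (d + 1) => ∑ l : Fin (d + 1), symVhKerAt (ctr (d + 1) Lc) Lc κ x (l, z) f' * B l z :=
  summable_sum fun l _ => summable_symVhKerAt_mul Lc hc κ x l f' (B l)

omit [NeZero Lc] in
/-- [folklore] an1's symmetrised kernel is finitely supported in the BACKGROUND bond too (an1's `symVhKerAt_eq_zero_right`): the lattice pairing with any form vanishes when the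
background bond's base is off an1's box `Near Lc x`. -/
theorem tsum_symVhKerAt_mul_eq_zero_of_not_mem (hc : ctrOff (d + 1) Lc ∈ box (d + 1) Lc) (κ : Fin (d + 1)) (x : Site (d + 1)) {f' : Bond (d + 1)}
    (hf' : f'.2 ∉ nearBox Lc x) (B : Form1 (d + 1) ℝ) :
    ∑' z : Site (d + 1), ∑ l : Fin (d + 1), symVhKerAt (ctr (d + 1) Lc) Lc κ x (l, z) f' * B l z = 0 := by
  refine (tsum_congr fun z => ?_).trans tsum_zero
  exact Finset.sum_eq_zero fun l _ => by rw [symVhKerAt_ctr_eq_zero_right Lc hc _ (fun h => hf' (mem_nearBox.2 h)), zero_mul]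

/-- [folklore] **`sum_perF_dper_symVhSAt_mul_periodic` — THE TORUS INSERTION OF an1's SYMMETRISED TABLE AT ONE TORUS BOND ACTS ON PERIODIC FORMS AS an1's SYMMETRISED KERNEL, COPY BY
COPY**: at the centred root, a background bond `(κ′, u)`, a `fine Lc M`-periodic real 1-form `B`, a coarse point `x ∈ pbox M` and a direction `κ`,
`Σ_{y ∈ pbox (fine Lc M)} Σ_l perF (fine Lc M) (dper (fine Lc M) (symVhSAt (ctr (d + 1) Lc) d Lc rfl κ′ u)) (coarsePt x, inr κ) (y, inl l) · B l y
 = Σ'_m Σ'_z Σ_l symVhKerAt (ctr (d + 1) Lc) Lc κ x (l, z) (κ′, u + (fine Lc M)∘m) · B l z`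
(`dper_apply_of_blockCov` with `symVhSAt_translate`: the insertion is the sum over the translated copies of the bond; §1; `symVhSAt_zsmul_inr_inl`; every sum finite). -/
theorem sum_perF_dper_symVhSAt_mul_periodic (hc : ctrOff (d + 1) Lc ∈ box (d + 1) Lc) (κ' : Fin (d + 1)) (u : Site (d + 1)) (B : Form1 (d + 1) ℝ)
    (hB : ∀ (l : Fin (d + 1)) (y m : Site (d + 1)), B l (translate (fine Lc M) y m) = B l y) (x : ↥(pbox M)) (κ : Fin (d + 1)) :
    ∑ y : ↥(pbox (fine Lc M)), ∑ l : Fin (d + 1),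
        perF (fine Lc M) (dper (fine Lc M) (symVhSAt (ctr (d + 1) Lc) d Lc rfl κ' u)) (coarsePt M Lc x, Sum.inr κ) (y, Sum.inl l) * B l (y : Site (d + 1))
      = ∑' m : Site (d + 1), ∑' z : Site (d + 1), ∑ l : Fin (d + 1),
          symVhKerAt (ctr (d + 1) Lc) Lc κ (x : Site (d + 1)) (l, z) (κ', translate (fine Lc M) u m) * B l z := by
  have hL : 1 ≤ Lc := Nat.one_le_iff_ne_zero.mpr (NeZero.ne Lc)
  have hM : ∀ i, fine Lc M i = Lc * M i := fun i => rfl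
  -- the copies of the bond loading the block of `x` are finitely many
  obtain ⟨F, hF⟩ := exists_finset_translate (fine Lc M) (nearBox Lc (x : Site (d + 1))) u
  -- entry unfolding at the coarse multiplier site
  have hV : ∀ (m z : Site (d + 1)) (l : Fin (d + 1)),
      symVhSAt (ctr (d + 1) Lc) d Lc rfl κ' (translate (fine Lc M) u m) ((coarsePt M Lc x : ↥(pbox (fine Lc M))) : Site (d + 1)) z (Sum.inr κ) (Sum.inl l)
        = symVhKerAt (ctr (d + 1) Lc) Lc κ (x : Site (d + 1)) (l, z) (κ', translate (fine Lc M) u m) := fun m z l => by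
    rw [coarsePt_coe]; exact symVhSAt_zsmul_inr_inl Lc _ _ _ _ _ _ _
  -- the diagonally periodised table, entrywise, as a FINITE sum over those copies
  have hdper : ∀ (z : Site (d + 1)) (l : Fin (d + 1)),
      dper (fine Lc M) (symVhSAt (ctr (d + 1) Lc) d Lc rfl κ' u) ((coarsePt M Lc x : ↥(pbox (fine Lc M))) : Site (d + 1)) z (Sum.inr κ) (Sum.inl l)
        = ∑ m ∈ F, symVhKerAt (ctr (d + 1) Lc) Lc κ (x : Site (d + 1)) (l, z) (κ', translate (fine Lc M) u m) := fun z l => by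
    rw [dper_apply_of_blockCov hM (fun κ u t => symVhSAt_translate (ctr (d + 1) Lc) hL κ u t) κ' u]
    rw [tsum_eq_sum (s := F) fun m hm => ?_]
    · exact Finset.sum_congr rfl fun m _ => hV m z l
    · rw [hV]; exact symVhKerAt_ctr_eq_zero_right Lc hc _ (fun h => hF m hm (mem_nearBox.2 h))
  -- §1 applies: finite support in the fluctuation slot
  have hK : ∀ l : Fin (d + 1), Summable fun z : Site (d + 1) =>
      dper (fine Lc M) (symVhSAt (ctr (d + 1) Lc) d Lc rfl κ' u) ((coarsePt M Lc x : ↥(pbox (fine Lc M))) : Site (d + 1)) z (Sum.inr κ) (Sum.inl l) * B l z :=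
    fun l => summable_of_ne_finset_zero (s := nearBox Lc (x : Site (d + 1))) fun z hz => by
      rw [hdper, Finset.sum_eq_zero fun m _ => symVhKerAt_ctr_eq_zero_left Lc hc (f := (l, z)) (fun h => hz (mem_nearBox.2 h)) _, zero_mul]
  calc ∑ y : ↥(pbox (fine Lc M)), ∑ l : Fin (d + 1),
        perF (fine Lc M) (dper (fine Lc M) (symVhSAt (ctr (d + 1) Lc) d Lc rfl κ' u)) (coarsePt M Lc x, Sum.inr κ) (y, Sum.inl l) * B l (y : Site (d + 1))
      = ∑ y : ↥(pbox (fine Lc M)), ∑ l : Fin (d + 1),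
          perZ (fine Lc M) (dper (fine Lc M) (symVhSAt (ctr (d + 1) Lc) d Lc rfl κ' u)) ((coarsePt M Lc x : ↥(pbox (fine Lc M))) : Site (d + 1))
            (y : Site (d + 1)) (Sum.inr κ) (Sum.inl l) * B l (y : Site (d + 1)) := by
        simp only [perF_apply]
    _ = ∑' z : Site (d + 1), ∑ l : Fin (d + 1),
          dper (fine Lc M) (symVhSAt (ctr (d + 1) Lc) d Lc rfl κ' u) ((coarsePt M Lc x : ↥(pbox (fine Lc M))) : Site (d + 1)) z (Sum.inr κ) (Sum.inl l) * B l z :=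
        sum_perZ_mul_periodic (fine Lc M) _ _ κ B hB hK
    _ = ∑' z : Site (d + 1), ∑ m ∈ F, ∑ l : Fin (d + 1), symVhKerAt (ctr (d + 1) Lc) Lc κ (x : Site (d + 1)) (l, z) (κ', translate (fine Lc M) u m) * B l z := by
        refine tsum_congr fun z => ?_
        rw [Finset.sum_comm]
        exact Finset.sum_congr rfl fun l _ => by rw [hdper z l, Finset.sum_mul]
    _ = ∑ m ∈ F, ∑' z : Site (d + 1), ∑ l : Fin (d + 1), symVhKerAt (ctr (d + 1) Lc) Lc κ (x : Site (d + 1)) (l, z) (κ', translate (fine Lc M) u m) * B l z :=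
        Summable.tsum_finsetSum fun m _ => summable_sum_symVhKerAt_mul Lc hc κ _ _ B
    _ = ∑' m : Site (d + 1), ∑' z : Site (d + 1), ∑ l : Fin (d + 1),
          symVhKerAt (ctr (d + 1) Lc) Lc κ (x : Site (d + 1)) (l, z) (κ', translate (fine Lc M) u m) * B l z :=
        (tsum_eq_sum fun m hm => tsum_symVhKerAt_mul_eq_zero_of_not_mem Lc hc κ _ (f' := (κ', translate (fine Lc M) u m)) (hF m hm) B).symm

end Bond

/-! ## §3 The weighted sum: `stepIns₁Sym w` acts on periodic forms as `symVhKerAt` at (the form, the periodic lift of the weight) -/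

section Step

variable (M : Fin (d + 1) → ℕ) [∀ μ, NeZero (M μ)] (Lc : ℕ) [NeZero Lc]

/-- [folklore] **`sum_stepIns₁Sym_mul_periodic_eq_sum_bonds` — THE SYM ONE-STEP INSERTION JET ACTS ON PERIODIC FORMS AS an1's SYMMETRISED KERNEL, BOND BY BOND** (twin of R-5 §3): a torus
bond weight `w`, a `fine Lc M`-periodic real 1-form `B`, `x ∈ pbox M`, `κ`:
`Σ_q stepIns₁Sym M Lc w (x, κ) q · B q.2 q.1 = Σ_b w b · Σ'_m Σ'_z Σ_l symVhKerAt (ctr (d + 1) Lc) Lc κ x (l, z) (b.2, b.1 + (fine Lc M)∘m) · B l z` (unfold `stepIns₁`, §2 per bond). -/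
theorem sum_stepIns₁Sym_mul_periodic_eq_sum_bonds (hc : ctrOff (d + 1) Lc ∈ box (d + 1) Lc) (w : ↥(pbox (fine Lc M)) × Fin (d + 1) → ℝ) (B : Form1 (d + 1) ℝ)
    (hB : ∀ (l : Fin (d + 1)) (y m : Site (d + 1)), B l (translate (fine Lc M) y m) = B l y) (x : ↥(pbox M)) (κ : Fin (d + 1)) :
    ∑ q : ↥(pbox (fine Lc M)) × Fin (d + 1), stepIns₁Sym M Lc w (x, κ) q * B q.2 (q.1 : Site (d + 1))
      = ∑ b : ↥(pbox (fine Lc M)) × Fin (d + 1), w b *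
          ∑' m : Site (d + 1), ∑' z : Site (d + 1), ∑ l : Fin (d + 1),
            symVhKerAt (ctr (d + 1) Lc) Lc κ (x : Site (d + 1)) (l, z) (b.2, translate (fine Lc M) (b.1 : Site (d + 1)) m) * B l z := by
  have hentry : ∀ q : ↥(pbox (fine Lc M)) × Fin (d + 1), stepIns₁Sym M Lc w (x, κ) q
      = ∑ b : ↥(pbox (fine Lc M)) × Fin (d + 1), w b *
          perF (fine Lc M) (dper (fine Lc M) (symVhSAt (ctr (d + 1) Lc) d Lc rfl b.2 (b.1 : Site (d + 1)))) (coarsePt M Lc x, Sum.inr κ) (q.1, Sum.inl q.2) := fun q => by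
    rw [stepIns₁Sym, Matrix.sum_apply]
    exact Finset.sum_congr rfl fun b _ => by rw [Matrix.smul_apply, Matrix.submatrix_apply, smul_eq_mul]
  calc ∑ q : ↥(pbox (fine Lc M)) × Fin (d + 1), stepIns₁Sym M Lc w (x, κ) q * B q.2 (q.1 : Site (d + 1))
      = ∑ q : ↥(pbox (fine Lc M)) × Fin (d + 1), ∑ b : ↥(pbox (fine Lc M)) × Fin (d + 1), w b *
          (perF (fine Lc M) (dper (fine Lc M) (symVhSAt (ctr (d + 1) Lc) d Lc rfl b.2 (b.1 : Site (d + 1)))) (coarsePt M Lc x, Sum.inr κ) (q.1, Sum.inl q.2)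
            * B q.2 (q.1 : Site (d + 1))) := by
        refine Finset.sum_congr rfl fun q _ => ?_
        rw [hentry, Finset.sum_mul]
        exact Finset.sum_congr rfl fun b _ => mul_assoc _ _ _
    _ = ∑ b : ↥(pbox (fine Lc M)) × Fin (d + 1), w b * ∑ q : ↥(pbox (fine Lc M)) × Fin (d + 1),
          perF (fine Lc M) (dper (fine Lc M) (symVhSAt (ctr (d + 1) Lc) d Lc rfl b.2 (b.1 : Site (d + 1)))) (coarsePt M Lc x, Sum.inr κ) (q.1, Sum.inl q.2)
            * B q.2 (q.1 : Site (d + 1)) := by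
        rw [Finset.sum_comm]
        exact Finset.sum_congr rfl fun b _ => (Finset.mul_sum _ _ _).symm
    _ = _ := by
        refine Finset.sum_congr rfl fun b _ => ?_
        rw [Fintype.sum_prod_type, sum_perF_dper_symVhSAt_mul_periodic M Lc hc b.2 (b.1 : Site (d + 1)) B hB x κ]

/-- [folklore] **`sum_stepIns₁Sym_mul_periodic` — THE ONE-STEP INSERTION JET `stepIns₁ w` ACTS ON `fine Lc M`-PERIODIC 1-FORMS AS an1's ROOTED FIELD–MULTIPLIER KERNEL
SUMMED AGAINST (THE FORM, THE PERIODIC LIFT OF THE WEIGHT)**: for `r ∈ box`, a torus bond weight `w` with `fine Lc M`-periodic lift `(κ′, u) ↦ w (wrapPt (fine Lc M) u, κ′)`,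
a `fine Lc M`-periodic real 1-form `B`, `x ∈ pbox M` and `κ`,
`Σ_q stepIns₁Sym M Lc w (x, κ) q · B q.2 q.1 = Σ'_u Σ_{κ′} (Σ'_z Σ_l symVhKerAt (ctr (d + 1) Lc) Lc κ x (l, z) (κ′, u) · B l z) · w (wrapPt (fine Lc M) u, κ′)`
— every sum is finite (both bonds lie in an1's box `Near Lc x`). -/
theorem sum_stepIns₁Sym_mul_periodic (hc : ctrOff (d + 1) Lc ∈ box (d + 1) Lc) (w : ↥(pbox (fine Lc M)) × Fin (d + 1) → ℝ) (B : Form1 (d + 1) ℝ)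
    (hB : ∀ (l : Fin (d + 1)) (y m : Site (d + 1)), B l (translate (fine Lc M) y m) = B l y) (x : ↥(pbox M)) (κ : Fin (d + 1)) :
    ∑ q : ↥(pbox (fine Lc M)) × Fin (d + 1), stepIns₁Sym M Lc w (x, κ) q * B q.2 (q.1 : Site (d + 1))
      = ∑' u : Site (d + 1), ∑ κ' : Fin (d + 1),
          (∑' z : Site (d + 1), ∑ l : Fin (d + 1), symVhKerAt (ctr (d + 1) Lc) Lc κ (x : Site (d + 1)) (l, z) (κ', u) * B l z)
            * w (wrapPt (fine Lc M) u, κ') := by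
  -- the lattice functional of the background bond, and its finite support in the bond's base
  set G : Fin (d + 1) → Site (d + 1) → ℝ := fun κ' u =>
    ∑' z : Site (d + 1), ∑ l : Fin (d + 1), symVhKerAt (ctr (d + 1) Lc) Lc κ (x : Site (d + 1)) (l, z) (κ', u) * B l z with hG
  have hG0 : ∀ (κ' : Fin (d + 1)) (u : Site (d + 1)), u ∉ nearBox Lc (x : Site (d + 1)) → G κ' u = 0 := fun κ' u hu =>
    tsum_symVhKerAt_mul_eq_zero_of_not_mem Lc hc κ _ (f' := (κ', u)) hu B
  -- the summand of the right-hand side is finitely supported, hence summable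
  have hS : Summable fun u : Site (d + 1) => ∑ κ' : Fin (d + 1), G κ' u * w (wrapPt (fine Lc M) u, κ') :=
    summable_of_ne_finset_zero (s := nearBox Lc (x : Site (d + 1))) fun u hu =>
      Finset.sum_eq_zero fun κ' _ => by rw [hG0 κ' u hu, zero_mul]
  rw [sum_stepIns₁Sym_mul_periodic_eq_sum_bonds M Lc hc w B hB x κ]
  -- right-hand side: lattice = box × period lattice; the lift reads the weight at the box point
  rw [tsum_sites_eq_sum_tsum (fine Lc M) hS, Fintype.sum_prod_type]
  refine Finset.sum_congr rfl fun y _ => ?_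
  have hwrap : ∀ (m : Site (d + 1)) (κ' : Fin (d + 1)),
      w (wrapPt (fine Lc M) (translate (fine Lc M) (y : Site (d + 1)) m), κ') = w (y, κ') := fun m κ' => by
    congr 2
    exact Subtype.ext (wrap_translate (fine Lc M) y.2 m)
  -- along the translates of `y` the family sum is finite
  obtain ⟨F, hF⟩ := exists_finset_translate (fine Lc M) (nearBox Lc (x : Site (d + 1))) (y : Site (d + 1))
  have hfin : ∀ κ' : Fin (d + 1), ∑' m : Site (d + 1), G κ' (translate (fine Lc M) (y : Site (d + 1)) m)
      = ∑ m ∈ F, G κ' (translate (fine Lc M) (y : Site (d + 1)) m) := fun κ' => tsum_eq_sum fun m hm => hG0 κ' _ (hF m hm)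
  calc ∑ κ' : Fin (d + 1), w (y, κ') * ∑' m : Site (d + 1), G κ' (translate (fine Lc M) (y : Site (d + 1)) m)
      = ∑ κ' : Fin (d + 1), ∑ m ∈ F, G κ' (translate (fine Lc M) (y : Site (d + 1)) m) * w (y, κ') := by
        refine Finset.sum_congr rfl fun κ' _ => ?_
        rw [hfin, mul_comm, Finset.sum_mul]
    _ = ∑ m ∈ F, ∑ κ' : Fin (d + 1), G κ' (translate (fine Lc M) (y : Site (d + 1)) m) * w (y, κ') := Finset.sum_comm
    _ = ∑' m : Site (d + 1), ∑ κ' : Fin (d + 1), G κ' (translate (fine Lc M) (y : Site (d + 1)) m) * w (y, κ') :=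
        (tsum_eq_sum fun m hm => Finset.sum_eq_zero fun κ' _ => by rw [hG0 κ' _ (hF m hm), zero_mul]).symm
    _ = ∑' m : Site (d + 1), ∑ κ' : Fin (d + 1),
          G κ' (translate (fine Lc M) (y : Site (d + 1)) m) * w (wrapPt (fine Lc M) (translate (fine Lc M) (y : Site (d + 1)) m), κ') := by
        simp only [hwrap]

end Step

end Summit.QuantumFields.BalabanUV.Beta.FP.TorusStepInsertionSym

end
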